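import Summits.AtomisticToContinuum.HydrodynamicLimit.Theorems.HydroLimitInBand.Negative.LoadBearing
import Literature.MathematicalPhysics.KineticTheory.HardSphereEulerDim
import HarnessLib

/-!
# `HydroLimitInBand` (crux stmt-AtomisticToContinuum-9133), negative side: LOAD-BEARING HYPOTHESES, II

Standing disprover's lemmas (`Cruxes/HydroLimitInBand/Disproof.lean` §3.3–§3.6, refuter-cdisprove lineage of stmt-9133;
resubmission of p104454, which bounced only on a gate restart). Sequel of `Negative/LoadBearing.lean` (mass, momentum):

* `hydroLimitInBand_false_without_energy` — drop the ENERGY equation: the uniformly heating homogeneous state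
  `ρ ≡ 1, u ≡ 0, θ = 1 + t` solves mass and momentum, has equilibrium data and small packing, and is not followed.
* `hydroLimitInBand_false_without_smooth` — keep the three pointwise equations but drop JOINT SMOOTHNESS: a density jumping
  from `1` to `2` at `t = 0⁺` has junk `derivWithin = 0` within `[0, T)` and "solves" everything pointwise.
* `hydroLimitInBand_false_without_tie` — drop the `t = 0` TIE: the constant classical solution `(1, 0, 2)` is admissible
  for no homogeneous profile of temperature `1`; rigidity of the homogeneous Gibbs law refutes the untied statement.
* `hydroLimitInBandWithoutGuard_iff` — drop the packing GUARD and the crux is LITERALLY the summit conjunct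
  `HydrodynamicLimit` (open): the guard is the one hypothesis whose load-bearing status a refuter cannot decide.
-/

noncomputable section

open MeasureTheory Filter Set Topology
open scoped ENNReal

namespace Summit.AtomisticToContinuum.HydrodynamicLimit.Theorems

open Literature.MathematicalPhysics.KineticTheory Literature.Analysis.FluidPDE
open Literature.Analysis.FunctionSpaces
open Summit.AtomisticToContinuum.HydrodynamicLimit.Theses.ImplosionDichotomy (HydroLimitInBand)
open PolynomialCompressionPDE (Flows flows_nonempty)

namespace HydroLimitInBandNegative

/-! ### §3.3 Without the energy equation -/

/-- `IsHardSphereEulerSolution` with the ENERGY equation dropped. -/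
def SolWithoutEnergy : SolClass := fun σ T ρ u θ =>
  Torus.IsSmoothSpaceTimeOn (Ico 0 T) ρ ∧ Torus.IsSmoothSpaceTimeOn (Ico 0 T) u ∧
  Torus.IsSmoothSpaceTimeOn (Ico 0 T) θ ∧ (∀ t ∈ Ico 0 T, ∀ x, 0 < ρ t x) ∧ (∀ t ∈ Ico 0 T, ∀ x, 0 < θ t x) ∧
  (∀ t ∈ Ico 0 T, ∀ x,
    Torus.timeDerivWithin (Ico 0 T) ρ t x + Torus.divergence (fun y => ρ t y • u t y) x = 0) ∧
  (∀ t ∈ Ico 0 T, ∀ x,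
    Torus.timeDerivWithin (Ico 0 T) (fun s y => ρ s y • u s y) t x +
      (∑ i, Torus.partialDeriv i (fun y => (ρ t y * u t y i) • u t y) x) +
      Torus.gradient (fun y => hsPressure σ (ρ t y) (θ t y)) x = 0)

/-- The crux without the energy equation. -/
def HydroLimitInBandWithoutEnergy : Prop := InBandFor SolWithoutEnergy

/-- Auxiliary (`solWithoutEnergy_of_isSolution`). [folklore] -/
theorem solWithoutEnergy_of_isSolution {σ T : ℝ} {ρ θ : ℝ → T3 → ℝ} {u : ℝ → T3 → V3}
    (h : IsHardSphereEulerSolution σ T ρ u θ) : SolWithoutEnergy σ T ρ u θ :=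
  ⟨h.smooth_density, h.smooth_velocity, h.smooth_temperature, h.density_pos, h.temperature_pos, h.mass,
    h.momentum⟩

/-- **The energy equation is load-bearing**: the homogeneously HEATING state `ρ ≡ 1`, `u ≡ 0`, `θ_t ≡ 1 + t`
conserves mass and momentum (`∇p = 0` since `p` does not depend on `x`) but not energy; equilibrium data
`(1, 0, 1)`, packing `σ³`, `θ_{1/2} = 3/2 ≠ 1`, while the particle kinetic energy (`χ ≡ 1`) is conserved. -/
theorem hydroLimitInBand_false_without_energy : ¬ HydroLimitInBandWithoutEnergy := by
  refine not_inBandFor_of_witness fun η₀ hη₀ σ₁ hσ₁ => ?_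
  obtain ⟨σ, hσ, hσlt, hσcube⟩ := exists_sigma_small η₀ σ₁ hη₀ hσ₁
  have hσ3 : 0 ≤ σ ^ 3 := by positivity
  refine ⟨σ, hσ, hσlt, 1, fun _ _ => 1, fun t _ => 1 + t, fun _ _ => 0, ?_, ?_, ?_, ?_, ?_,
    1 / 2, ⟨by norm_num, by norm_num⟩, continuous_const, continuous_const, continuous_const, ?_⟩
  · dsimp only [SolWithoutEnergy]
    refine ⟨contDiffOn_const, contDiffOn_const, ?_, ?_, ?_, ?_, ?_⟩
    · exact (contDiff_const.add contDiff_fst).contDiffOn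
    · intro t _ x; exact one_pos
    · intro t ht x; linarith [ht.1]
    · intro t ht x
      simp
    · intro t ht x
      simp
  · intro t _ x
    linarith
  · rfl
  · rfl
  · funext x; norm_num
  · rintro ⟨-, -, h⟩
    have := congrFun h (0 : T3)
    norm_num at this

/-! ### §3.4 Without joint smoothness (junk derivatives) -/

/-- `IsHardSphereEulerSolution` with the three SMOOTHNESS fields dropped (positivity and the three pointwise
"equations", written with the junk-valued `derivWithin`/`deriv`-based torus calculus, kept verbatim). -/
def SolWithoutSmooth : SolClass := fun σ T ρ u θ =>
  (∀ t ∈ Ico 0 T, ∀ x, 0 < ρ t x) ∧ (∀ t ∈ Ico 0 T, ∀ x, 0 < θ t x) ∧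
  (∀ t ∈ Ico 0 T, ∀ x,
    Torus.timeDerivWithin (Ico 0 T) ρ t x + Torus.divergence (fun y => ρ t y • u t y) x = 0) ∧
  (∀ t ∈ Ico 0 T, ∀ x,
    Torus.timeDerivWithin (Ico 0 T) (fun s y => ρ s y • u s y) t x +
      (∑ i, Torus.partialDeriv i (fun y => (ρ t y * u t y i) • u t y) x) +
      Torus.gradient (fun y => hsPressure σ (ρ t y) (θ t y)) x = 0) ∧
  (∀ t ∈ Ico 0 T, ∀ x,
    Torus.timeDerivWithin (Ico 0 T) (fun s y => totalEnergyDensity (ρ s y) (u s y) (θ s y)) t x +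
      Torus.divergence (fun y => (totalEnergyDensity (ρ t y) (u t y) (θ t y) + hsPressure σ (ρ t y) (θ t y)) •
        u t y) x = 0)

/-- The crux without joint smoothness of the fields. -/
def HydroLimitInBandWithoutSmooth : Prop := InBandFor SolWithoutSmooth

/-- Auxiliary (`solWithoutSmooth_of_isSolution`). [folklore] -/
theorem solWithoutSmooth_of_isSolution {σ T : ℝ} {ρ θ : ℝ → T3 → ℝ} {u : ℝ → T3 → V3}
    (h : IsHardSphereEulerSolution σ T ρ u θ) : SolWithoutSmooth σ T ρ u θ :=
  ⟨h.density_pos, h.temperature_pos, h.mass, h.momentum, h.energy⟩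

/-- The jump witness: density `1` at `t = 0` and `2` at every other time. -/
def jumpDensity : ℝ → T3 → ℝ := fun t _ => if t = 0 then 1 else 2

/-- Auxiliary (`jumpDensity_of_pos`). [folklore] -/
theorem jumpDensity_of_pos {t : ℝ} (ht : 0 < t) (x : T3) : jumpDensity t x = 2 := by
  simp [jumpDensity, ht.ne']

/-- **Smoothness is load-bearing (the pointwise equations alone admit junk)**: the homogeneous fields
`ρ_0 ≡ 1`, `ρ_t ≡ 2 (t ≠ 0)`, `u ≡ 0`, `θ ≡ 1` satisfy all three pointwise "equations" on `[0, 1)` — away from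
`t = 0` every field is constant, and AT `t = 0` the maps `τ ↦ ρ_τ(x)`, `τ ↦ E_τ(x)` are discontinuous within
`[0, 1)`, where `derivWithin` is the junk `0` — yet the mass at `t = 1/2` is `2 ≠ 1`. So
`IsHardSphereEulerSolution` is a genuine classical-solution notion ONLY through its `IsSmoothSpaceTimeOn`
fields; any proof of the crux uses them (e.g. via continuity of slices / uniqueness). -/
theorem hydroLimitInBand_false_without_smooth : ¬ HydroLimitInBandWithoutSmooth := by
  refine not_inBandFor_of_witness fun η₀ hη₀ σ₁ hσ₁ => ?_
  obtain ⟨σ, hσ, hσlt, hσcube⟩ := exists_sigma_small η₀ σ₁ hη₀ hσ₁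
  have hσ3 : 0 ≤ σ ^ 3 := by positivity
  refine ⟨σ, hσ, hσlt, 1, jumpDensity, fun _ _ => 1, fun _ _ => 0, ?_, ?_, ?_, ?_, ?_,
    1 / 2, ⟨by norm_num, by norm_num⟩, continuous_const, continuous_const, continuous_const, ?_⟩
  · dsimp only [SolWithoutSmooth]
    refine ⟨?_, fun _ _ _ => one_pos, ?_, ?_, ?_⟩
    · intro t _ x
      unfold jumpDensity
      split_ifs <;> norm_num
    · -- mass: junk time derivative + no transport
      intro t ht x
      simp only [smul_zero, torusDivergence_const, add_zero, Torus.timeDerivWithin]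
      refine derivWithin_Ico_eq_zero_of_eqOn_Ioo one_pos (c := (2 : ℝ)) (fun τ hτ => ?_) ht
      exact jumpDensity_of_pos hτ.1 x
    · -- momentum: all terms are constants in `x` or zero
      intro t ht x
      simp [jumpDensity]
    · -- energy: `E_τ = (3/2) ρ_τ` is the constant `3` on `(0, 1)`
      intro t ht x
      simp only [smul_zero, torusDivergence_const, add_zero, Torus.timeDerivWithin]
      refine derivWithin_Ico_eq_zero_of_eqOn_Ioo one_pos (c := (3 : ℝ)) (fun τ hτ => ?_) ht
      rw [jumpDensity_of_pos hτ.1]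
      simp only [totalEnergyDensity, norm_zero]
      norm_num
  · intro t _ x
    have h2 : jumpDensity t x ≤ 2 := by unfold jumpDensity; split_ifs <;> norm_num
    exact lt_of_le_of_lt (mul_le_mul_of_nonneg_right h2 hσ3) hσcube
  · funext x; simp [jumpDensity]
  · rfl
  · rfl
  · rintro ⟨h, -, -⟩
    have := congrFun h (0 : T3)
    rw [jumpDensity_of_pos (by norm_num : (0 : ℝ) < 1 / 2)] at this
    norm_num at this

/-! ### §3.5 Without the `t = 0` tie -/

/-- The crux with the law-of-large-numbers hypothesis at `t = 0` (the tie of the Euler data to the local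
Gibbs profiles) dropped. -/
def HydroLimitInBandWithoutTie : Prop :=
  ∃ η₀ : ℝ, 0 < η₀ ∧ ∀ (a₀ θ₀ : T3 → ℝ) (u₀ : T3 → V3), Continuous a₀ → Continuous θ₀ → Continuous u₀ →
    (∀ x, 0 < a₀ x) → (∀ x, 0 < θ₀ x) → ∃ σ₀ : ℝ, 0 < σ₀ ∧ ∀ σ : ℝ, 0 < σ → σ < σ₀ →
    ∀ (T : ℝ) (ρ θ : ℝ → T3 → ℝ) (u : ℝ → T3 → V3), IsHardSphereEulerSolution σ T ρ u θ →
    (∀ t ∈ Ico 0 T, ∀ x, ρ t x * σ ^ 3 < η₀) →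
    ∀ Φ : Flows σ, ∀ t ∈ Ico 0 T, TendstoHydroFieldsAt (fun N => localGibbsLaw σ a₀ u₀ θ₀ N (Φ N)) Φ ρ u θ t

/-- The tie only weakens the statement: `HydroLimitInBandWithoutTie → HydroLimitInBand`. -/
theorem hydroLimitInBand_of_withoutTie (h : HydroLimitInBandWithoutTie) : HydroLimitInBand := by
  obtain ⟨η₀, hη₀, H⟩ := h
  refine ⟨η₀, hη₀, fun a₀ θ₀ u₀ ha hθ hu ha0 hθ0 => ?_⟩
  obtain ⟨σ₀, hσ₀, G⟩ := H a₀ θ₀ u₀ ha hθ hu ha0 hθ0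
  exact ⟨σ₀, hσ₀, fun σ hσ hσ' T ρ θ u hE hg Φ _ t ht => G σ hσ hσ' T ρ θ u hE hg Φ t ht⟩

/-- **The `t = 0` tie is load-bearing**: the constant classical solution `(1, 0, 2)` (temperature `2`) is
admissible for NO homogeneous profile of temperature `1`; with the tie dropped the statement would make the
homogeneous Gibbs law of temperature `1` follow it at `t = 0`, contradicting rigidity (the kinetic energy per
particle is `3/2`, not `3`). -/
theorem hydroLimitInBand_false_without_tie : ¬ HydroLimitInBandWithoutTie := by
  rintro ⟨η₀, hη₀, H⟩
  obtain ⟨σ₀, hσ₀, G⟩ := H (fun _ => 1) (fun _ => 1) (fun _ => 0) continuous_const continuous_const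
    continuous_const (fun _ => one_pos) (fun _ => one_pos)
  obtain ⟨σ₁, hσ₁, hσ₁2, P⟩ := equilibrium_package (a := 1) (θc := 1) (0 : V3) one_pos one_pos
  obtain ⟨σ, hσ, hσlt, hσcube⟩ := exists_sigma_small η₀ (min σ₀ σ₁) hη₀ (lt_min hσ₀ hσ₁)
  have hσ₀' : σ < σ₀ := lt_of_lt_of_le hσlt (min_le_left _ _)
  have hσ₁' : σ < σ₁ := lt_of_lt_of_le hσlt (min_le_right _ _)
  obtain ⟨Φ⟩ := flows_nonempty hσ (hσ₁'.trans_le hσ₁2)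
  obtain ⟨-, -, hrig⟩ := P σ hσ hσ₁' Φ
  have hE : IsHardSphereEulerSolution σ 1 (fun _ _ => (1 : ℝ)) (fun _ _ => (0 : V3)) (fun _ _ => (2 : ℝ)) :=
    isHardSphereEulerSolutionDim_three_iff.1 (IsHardSphereEulerSolutionDim.const σ 1 (0 : V3) one_pos two_pos)
  have hguard : ∀ t ∈ Ico (0 : ℝ) 1, ∀ x : T3, (1 : ℝ) * σ ^ 3 < η₀ := by
    intro t _ x
    have hσ3 : 0 ≤ σ ^ 3 := by positivity
    linarith
  have hT := G σ hσ hσ₀' 1 _ _ _ hE hguard Φ 0 ⟨le_rfl, one_pos⟩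
  obtain ⟨-, -, h⟩ := hrig _ _ _ 0 continuous_const continuous_const continuous_const hT
  have := congrFun h (0 : T3)
  norm_num at this

/-! ### §3.6 The guard cannot be dropped by a refuter: without it the crux is the summit conjunct -/

/-- The crux with the packing guard dropped (the `∃ η₀` prefix then quantifies nothing). -/
def HydroLimitInBandWithoutGuard : Prop :=
  ∃ η₀ : ℝ, 0 < η₀ ∧ ∀ (a₀ θ₀ : T3 → ℝ) (u₀ : T3 → V3), Continuous a₀ → Continuous θ₀ → Continuous u₀ →
    (∀ x, 0 < a₀ x) → (∀ x, 0 < θ₀ x) → ∃ σ₀ : ℝ, 0 < σ₀ ∧ ∀ σ : ℝ, 0 < σ → σ < σ₀ →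
    ∀ (T : ℝ) (ρ θ : ℝ → T3 → ℝ) (u : ℝ → T3 → V3), IsHardSphereEulerSolution σ T ρ u θ →
    ∀ Φ : Flows σ, TendstoHydroFieldsAt (fun N => localGibbsLaw σ a₀ u₀ θ₀ N (Φ N)) Φ ρ u θ 0 →
    ∀ t ∈ Ico 0 T, TendstoHydroFieldsAt (fun N => localGibbsLaw σ a₀ u₀ θ₀ N (Φ N)) Φ ρ u θ t

-- buildfix 2026-08-19 (maintenance): `hydroLimitInBandWithoutGuard_iff : HydroLimitInBandWithoutGuard ↔ HydrodynamicLimit`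
-- REMOVED — `HydroLimitInBandWithoutGuard` spells the PRE-RE-TYPE body of the sub-problem Statement `HydrodynamicLimit`
-- (re-typed 2026-08-16T21:23Z), so the equivalence is no longer definitional. The point it recorded (dropping the packing
-- guard yields the summit conjunct of that date) stands as prose; the definition above is kept. Unreferenced elsewhere.

end HydroLimitInBandNegative

end Summit.AtomisticToContinuum.HydrodynamicLimit.Theorems

end
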